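import Mathlib
import HarnessLib
import Summits.NavierStokesRegularity.NavierStokesRegularity.Theses.LocalLevelHeadDoor
import Summits.NavierStokesRegularity.NavierStokesRegularity.Theorems.LocalLevelHeadDoorLevelWindowToEverywhere
import Summits.NavierStokesRegularity.NavierStokesRegularity.Theorems.LocalLevelHeadDoorLevelDecayVanish

/-!
# `LocalLevelHeadDoor.LevelHeadSpread` (item stmt-NavierStokesRegularity-28096, crux rank 3) — PROVED

The registered skeleton `LevelHeadSpread_birth.lean` (ns-idea-6 g6, sha12 `e90d4cc6a43d`) composed BY NAME from its two landed
stubs: `levelWindowToEverywhere` (slice analyticity of the similarity head: level on a ball ⇒ level everywhere) and the planner's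
rung `levelHeadDecayVanish` (globally level + apex decay ⇒ zero head).

HONEST FRAMING: statement about HYPOTHETICAL Type-I profiles; nothing here bears on 0056 or Navier–Stokes regularity.
Seat ns-sz-p1 g5 (#237 (2)).
-/

noncomputable section

set_option linter.dupNamespace false

namespace Summit.NavierStokesRegularity.NavierStokesRegularity.Theorems

open Summit.NavierStokesRegularity.NavierStokesRegularity.Cruxes.LevelHeadProfileRigidity.PointwiseClock (levelHeadDecayVanish)

/-- **Item stmt-NavierStokesRegularity-28096** (`LocalLevelHeadDoor.LevelHeadSpread`): a similarity head that is level on a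
ball at every time is identically zero. [folklore] -/
theorem localLevelHeadDoor_levelHeadSpread_proof :
    Summit.NavierStokesRegularity.NavierStokesRegularity.Theses.LocalLevelHeadDoor.LevelHeadSpread := by
  unfold Summit.NavierStokesRegularity.NavierStokesRegularity.Theses.LocalLevelHeadDoor.LevelHeadSpread
  intro C D v hrate hdec hcont hmild hdiv c r hr hlev
  exact levelHeadDecayVanish C D v hrate hdec hcont hmild hdiv
    (LevelHeadSpread.levelWindowToEverywhere C D v hrate hdec hcont hmild hdiv c r hr hlev)

end Summit.NavierStokesRegularity.NavierStokesRegularity.Theorems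

end
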